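import Summits.CriticalPhenomena.Ising3DConformalLimit.Theses.MonotoneRG
import Summits.CriticalPhenomena.Ising3DConformalLimit.Theorems.ZoomMonotone.Negative.DoublingWitness
import Literature.Probability.LatticeModels.CriticalAxisRatioRegularity
import Literature.Probability.LatticeModels.HighDimPointwiseTriviality
import Literature.Probability.LatticeModels.Sweep1

/-!
# `ZoomMonotone` (item stmt-CriticalPhenomena-14454), negative lemma, part 2/2: the tree's axis
# structure does NOT decide the cheapest instance of the crux (refuter, crux-attack 2026-08-16)

* `axisFacts_criticalTwoPoint`: the critical axis two-point function `g(k) = ⟨σ₀σ_{k e₀}⟩_{β_c}` on `ℤ³`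
  has every property in `AxisFacts` (all of them tree theorems: `criticalTwoPoint_zero'`, Simon–Lieb
  positivity and the infrared/Simon–Lieb window `criticalTwoPoint_bounds_holds`, `criticalTwoPoint_le_one'`,
  `criticalTwoPoint_axis_succ_le`, log-convexity `criticalTwoPoint_axis_sq_le` (ADC21 Prop. 5.3),
  `criticalTwoPoint_axis_ratio_mono`, `criticalTwoPoint_axis_ratio_tendsto_one'`).
* `zoomMonotone_doubling`: `MonotoneRG.ZoomMonotone` implies `EventuallyMonotoneDoubling g` (its
  instance `n = 2`, `x = (0, 2e₀)`; exact mesh bookkeeping at `δ = 1/m` and `criticalCorr_two_pair`).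
* With part 1's `axisFacts_not_sufficient` (`∃ g', AxisFacts g' ∧ ¬ EventuallyMonotoneDoubling g'`):
  `doubling_instance_independent_of_axisFacts` — no argument from the axis-facts package alone proves
  even the cheapest instance of `ZoomMonotone`; a proof must import input on `⟨σ₀σ_x⟩_{β_c}` not
  presently in the tree (every-scale doubling WITH a rate and a sign, at least).

References: M. Aizenman, H. Duminil-Copin, Ann. Math. 194 (2021) [AizenmanDuminilCopinAnnals2021];
B. Simon, CMP 77 (1980) [Simon1980]; H. Duminil-Copin, Lectures on the Ising and Potts models (2019),
Thm. 4.8 [DuminilCopin2019].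
-/

noncomputable section

open Real Finset Filter Set
open scoped Topology
open Literature.Probability.LatticeModels

namespace Summit.CriticalPhenomena.Ising3DConformalLimit.Theorems.ZoomMonotone.Negative

/-- `g(k) = ⟨σ₀σ_{k e₀}⟩_{β_c(3)}`. [folklore] -/
def gAxis (k : ℕ) : ℝ := criticalTwoPoint 3 (Pi.single 0 (k : ℤ))

/-- `0 < g(k)` (Simon–Lieb off the origin, `= 1` at it). [cite: Simon1980, Thm. 1] -/
theorem gAxis_pos (k : ℕ) : 0 < gAxis k := by
  unfold gAxis
  by_cases hx : (Pi.single 0 (k : ℤ) : Site 3) = 0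
  · rw [hx, criticalTwoPoint_zero']; exact one_pos
  · obtain ⟨c, C, hc, hb⟩ := criticalTwoPoint_bounds_holds (d := 3) le_rfl
    exact lt_of_lt_of_le (mul_pos hc (Real.rpow_pos_of_pos (norm_pos_iff.2 hx) _)) (hb _ hx).1

/-- `‖k e₀‖_∞ = k`. [folklore] -/
theorem norm_single_nat (k : ℕ) : ‖(Pi.single 0 (k : ℤ) : Site 3)‖ = (k : ℝ) := by
  rw [Pi.norm_single, Int.norm_natCast]

/-- `k e₀ ≠ 0` for `k ≥ 1`. [folklore] -/
theorem single_nat_ne_zero {k : ℕ} (hk : 1 ≤ k) : (Pi.single 0 (k : ℤ) : Site 3) ≠ 0 := by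
  intro h
  have := congrFun h 0
  simp at this
  omega

/-- **The critical axis two-point function on `ℤ³` satisfies every field of `AxisFacts`** (all tree
theorems). [cite: AizenmanDuminilCopinAnnals2021, arXiv:1912.07973 Prop. 5.3 and §5.5 proof of Prop. 5.9] -/
theorem axisFacts_criticalTwoPoint : AxisFacts gAxis where
  zero := by simp [gAxis, criticalTwoPoint_zero']
  pos := gAxis_pos
  le_one k := criticalTwoPoint_le_one' _
  anti := by
    refine antitone_nat_of_succ_le fun k => ?_
    cases k with
    | zero =>
      show gAxis 1 ≤ gAxis 0
      rw [show gAxis 0 = 1 by simp [gAxis, criticalTwoPoint_zero']]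
      exact criticalTwoPoint_le_one' _
    | succ k => exact criticalTwoPoint_axis_succ_le 0 k
  logConvex n hn := by
    have h := criticalTwoPoint_axis_sq_le (0 : Fin 3) hn
    simpa [gAxis] using h
  ratioMono := criticalTwoPoint_axis_ratio_mono 0
  ratioTendsto := criticalTwoPoint_axis_ratio_tendsto_one' 0
  lower := by
    obtain ⟨c, C, hc, hb⟩ := criticalTwoPoint_bounds_holds (d := 3) le_rfl
    refine ⟨c, hc, fun k hk => ?_⟩
    have h1 := (hb _ (single_nat_ne_zero hk)).1
    rw [norm_single_nat] at h1
    have e : c * (k : ℝ) ^ (-(((3 : ℕ) : ℝ) - 1)) = c / (k : ℝ) ^ 2 := by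
      rw [show (-(((3 : ℕ) : ℝ) - 1)) = -((2 : ℕ) : ℝ) by norm_num, Real.rpow_neg (Nat.cast_nonneg k),
        Real.rpow_natCast, div_eq_mul_inv]
    rw [e] at h1
    exact h1
  upper := by
    obtain ⟨c, C, hc, hb⟩ := criticalTwoPoint_bounds_holds (d := 3) le_rfl
    refine ⟨C, fun k hk => ?_⟩
    have h2 := (hb _ (single_nat_ne_zero hk)).2
    rw [norm_single_nat] at h2
    have e : C * (k : ℝ) ^ (-(((3 : ℕ) : ℝ) - 2)) = C / (k : ℝ) := by
      rw [show (-(((3 : ℕ) : ℝ) - 2)) = (-1 : ℝ) by norm_num, Real.rpow_neg_one, div_eq_mul_inv]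
    rw [e] at h2
    exact h2

/-- `⌊(1/m)⁻¹⌋ = m`. [folklore] -/
theorem floor_inv_one_div (m : ℕ) : ⌊(1 / (m : ℝ))⁻¹⌋ = (m : ℤ) := by
  rw [one_div, inv_inv]
  exact Int.floor_natCast m

/-- `⌊z/(1/m)⌋ = z m`. [folklore] -/
theorem floor_int_div_one_div (m : ℕ) (z : ℤ) : ⌊(z : ℝ) / (1 / (m : ℝ))⌋ = z * m := by
  rw [div_div_eq_mul_div, div_one]
  have : ((z : ℝ) * (m : ℝ)) = ((z * (m : ℤ) : ℤ) : ℝ) := by push_cast; ring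
  rw [this, Int.floor_intCast]

/-- **`ZoomMonotone ⇒` the doubling ratio of the critical axis function is eventually monotone**
(instance `n = 2`, `x = (0, 2e₀)`). [folklore] -/
theorem zoomMonotone_doubling
    (h : Summit.CriticalPhenomena.Ising3DConformalLimit.Theses.MonotoneRG.ZoomMonotone) :
    EventuallyMonotoneDoubling gAxis := by
  set x : Fin 2 → EuclideanSpace ℝ (Fin 3) := fun i => siteVec (![0, Pi.single 0 2] i) with hxdef
  have hx : x ∈ NonCoincident 3 2 := by
    rw [mem_nonCoincident]
    intro i j hij
    fin_cases i <;> fin_cases j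
    · rfl
    · exfalso
      have := congrArg (fun v : EuclideanSpace ℝ (Fin 3) => v 0) hij
      simp [hxdef] at this
    · exfalso
      have := congrArg (fun v : EuclideanSpace ℝ (Fin 3) => v 0) hij
      simp [hxdef] at this
    · rfl
  have hz : ∀ i j, ∃ z : ℤ, x i j = (z : ℝ) := by
    intro i j
    exact ⟨(![0, Pi.single 0 2] i : Site 3) j, by simp [hxdef]⟩
  obtain ⟨m₀, hm⟩ := h 2 x hx hz
  have key : ∀ m : ℕ, rescaledCorrelator (criticalCorr 3)
      (fun δ : ℝ => (criticalTwoPoint 3 (Pi.single 0 ⌊δ⁻¹⌋)) ^ (-(1/2:ℝ))) 2 (1 / (m : ℝ)) x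
        = gAxis (2 * m) / gAxis m := by
    intro m
    rw [rescaledCorrelator_apply, floor_inv_one_div]
    have happrox : (fun i => latticeApprox (1 / (m : ℝ)) (x i)) = ![0, Pi.single 0 ((m : ℤ) * 2)] := by
      funext i
      fin_cases i
      · funext j
        simp [hxdef, latticeApprox_apply]
      · funext j
        simp only [hxdef, latticeApprox_apply, siteVec_apply, Matrix.cons_val_one,
          Matrix.cons_val_zero, Fin.mk_one]
        rw [floor_int_div_one_div]
        by_cases hj : j = 0
        · subst hj; simp [mul_comm]
        · simp [hj]
    rw [happrox, criticalCorr_two_pair, sub_zero]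
    have hg : 0 < criticalTwoPoint 3 (Pi.single 0 (m : ℤ)) := gAxis_pos m
    have hsq : ((criticalTwoPoint 3 (Pi.single 0 (m : ℤ))) ^ (-(1/2:ℝ))) ^ 2
        = (criticalTwoPoint 3 (Pi.single 0 (m : ℤ)))⁻¹ := by
      rw [← Real.rpow_natCast, ← Real.rpow_mul hg.le]
      norm_num
      exact Real.rpow_neg_one _
    rw [hsq, inv_mul_eq_div]
    unfold gAxis
    congr 3
    push_cast
    ring
  refine ⟨m₀, ?_⟩
  simp_rw [key] at hm
  exact hm

/-- **NEGATIVE LEMMA.** The real `g` has the axis facts, `ZoomMonotone` would make its doubling ratio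
eventually monotone, and yet some `g'` with ALL the axis facts has a doubling ratio that never settles:
the cheapest instance of `ZoomMonotone` is independent of everything presently proved about
`⟨σ₀σ_{k e₀}⟩_{β_c}`. [folklore] -/
theorem doubling_instance_independent_of_axisFacts :
    AxisFacts gAxis ∧
      (Summit.CriticalPhenomena.Ising3DConformalLimit.Theses.MonotoneRG.ZoomMonotone →
        EventuallyMonotoneDoubling gAxis) ∧
      ∃ g : ℕ → ℝ, AxisFacts g ∧ ¬ EventuallyMonotoneDoubling g :=
  ⟨axisFacts_criticalTwoPoint, zoomMonotone_doubling, axisFacts_not_sufficient⟩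

end Summit.CriticalPhenomena.Ising3DConformalLimit.Theorems.ZoomMonotone.Negative
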